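import Summits.HubbardSuperconductivity.HubbardSuperconductivity.Theorems.AnisotropyChordTransferFibre3RowDRhatCancelled
import Summits.HubbardSuperconductivity.HubbardSuperconductivity.Theorems.AnisotropyChordTransferFibre3PairSplit

/-!
# Route `AnisotropyChord` / H0 rotor rung: PartN41-D §3 — THE SPLIT `ResidSplit` PROVED (hence `RhatCancelled`)

Theory-1 g22's PartN41-D §3 `ResidSplit` (port …Fibre3KT2aRow; lib21 `chkM`, rowD_cancelled.py 1e-13): off `D`,
`R′ = v·(C0fn − (T⁺ − 3λ₂)Π⁰) + M`.  It is the commutator identity `H_{K₁}(vΠ⁰) = v·H₀Π⁰ + ε₁vΠ⁰ + mform3(f,f,f)`: the hops of the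
spectator factor `v = 1 + e^{iθa} + e^{iθb}` produce `(e^{iθe} − 1)`-weighted differences, the `±ŷ` directions drop (`e^{iK₁·ŷ} = 1`),
and the diagonal terms `Σ_{±x̂}(e^{iθe} − 1)vΠ⁰ = −2ε₁vΠ⁰` supply the `ε₁`.  ★ `residSplit_holds : ResidSplit L Δ`; with …RowDRhatCancelled,
★ `rhatCancelled_holds : RhatCancelled L Δ` (THE CANCELLED ONE-LOOP FORM of the low coefficients, typed).
Prover seat `hubbard-h0-rotor-p1` g27 (route lead); helper for stmt-HubbardSuperconductivity-23918 (`--supports`, helper class).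
WHAT THIS IS NOT: nothing here proves superconductivity in the Hubbard model.  Tree imports only; no new definitions; no sorry.
-/

set_option linter.dupNamespace false
set_option autoImplicit false

noncomputable section

open scoped BigOperators

namespace Summit.HubbardSuperconductivity.HubbardSuperconductivity.Theorems.AnisotropyChord.Transfer.Fibre3

variable (L : ℕ) [NeZero L]

/-- ★ **`ResidSplit L Δ` holds** (THE SPLIT). [folklore] -/
theorem residSplit_holds (Δ : ℝ) : ResidSplit L Δ := by
  intro lam2 f hL _hf _hev c hD
  have hL2 : 2 ≤ L := by omega
  obtain ⟨a, b⟩ := c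
  unfold resid residual trialK1 C0fn
  simp only [hD, Bool.false_eq_true, if_false]
  rw [Happly_zero_prodState_re, Happly_four]
  unfold mform3
  simp only [hopT, hopR, List.map_cons, List.map_nil, List.sum_cons, List.sum_nil, add_zero]
  have hp3 : ∀ x : Cfg L, prod3 L f f f x = piR L f x := fun x => rfl
  simp only [hp3, prodState_eq_piR]
  unfold vfun
  have hey := phase_K1_ey L
  have hε : (eps1 L : ℂ) = 1 - (phase L (K1 L) (ex L) + phase L (K1 L) (-ex L)) / 2 := eps1_eq_phase L hL2
  have hmul := phase_mul_neg L (K1 L) (ex L)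
  simp only [sub_eq_add_neg, neg_neg, phase_add, hey.1, hey.2, mul_one]
  push_cast
  linear_combination (-((1 + phase L (K1 L) a + phase L (K1 L) b) * (piR L f (a, b) : ℂ))) * hε
    + (-(1 / 2 : ℂ) * (phase L (K1 L) a + phase L (K1 L) b)
        * ((piR L f (a + -ex L, b + -ex L) : ℂ) + (piR L f (a + ex L, b + ex L) : ℂ))) * hmul

/-- ★ **`RhatCancelled L Δ` holds** (THE CANCELLED ONE-LOOP FORM). [folklore] -/
theorem rhatCancelled_holds (Δ : ℝ) : RhatCancelled L Δ :=
  RowD.rhatCancelled_of_residSplit L Δ (residSplit_holds L Δ)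

end Summit.HubbardSuperconductivity.HubbardSuperconductivity.Theorems.AnisotropyChord.Transfer.Fibre3

end
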